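import Mathlib
import HarnessLib
import Literature.Computability.AlgebraicComplexity.PatternExpressions
import Literature.Computability.AlgebraicComplexity.StandardFamilies
import Literature.RepresentationTheory.ClassicalInvariants.PowerSumBasicInvariants
import Literature.RepresentationTheory.ClassicalInvariants.ElementaryPowerSumSupport
import Summits.ValiantsHypothesis.ValiantsHypothesis.Theorems.MonotoneRestorationOrbitRestorationLinearVolumeQPRankOneShadow

/-!
# The permanent has no polynomial-dimension homomorphism expansion (calibration of R1, stmt-ValiantsHypothesis-18294)

Route MonotoneRestoration, item `OrbitRestorationLinearVolumeQP` (R1; its hypothesis class: VP families that are, at every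
level `n`, combinations `f n = Σ_{i<m_n} α_{n,i} · homPoly (E n i) n ℂ` of `m_n ≤ (n+2)^c` homomorphism polynomials of
bipartite multigraph patterns).  The item's informal statement says the class EXCLUDES THE PERMANENT ("its degree-`n` hom
expansion … runs over at least `p(n) = e^{Θ(√n)}` patterns").  This file PROVES that calibration, in the stronger
volume-free form:

* `perPoly_not_polyDimension_homExpansion` — there are no `c`, `m_n ≤ (n+2)^c` and patterns/coefficients with
  `per_n = Σ_{i<m_n} α_{n,i} hom_{F_{n,i},n}` for all `n`.

Proof (the rank-one / row shadow, not Möbius inversion): substitute `x_ij ↦ u_i` (`rowShadow_homPoly`: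
`hom_{F,n} ↦ n^{|B|} · Π_{a ∈ A} p_{deg a}(u)`, a product of POWER SUMS; `rowShadow_perPoly`: `per_n ↦ n!·u_1⋯u_n =
n!·e_n(u)`), keep the degree-`n` component, and read the identity in `ℂ[y_1, …, y_n] ≅ ℂ[u]^{𝔖_n}`, `y_j ↦ p_{j+1}`
(`PowerSumBasicInvariants.algebraicIndependent_psum`): the preimage `E_n` of `e_n` would be a combination of `≤ m_n`
monomials, whereas by Macdonald I (2.14′) (`ElementaryPowerSumSupport.coeff_ne_zero_of_aeval_psum_eq_esymm`) EVERY
weight-`n` monomial occurs in `E_n` — at least `2^t` of them for `t(t+3)/2 ≤ n` (`card_weightVectors_ge`), which beats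
`(n+2)^c`.

Honest framing: a calibration (negative membership) lemma for an OPEN aside item; R1, the crux `OrbitRestorationQP` and
`VP ≠ VNP` are untouched. [cite: DwivediPagoSeppelt2026, §1 eq. (1) and Outlook (p. 12)]
-/

noncomputable section

open MvPolynomial Finset

-- `Summit.ValiantsHypothesis.ValiantsHypothesis.…` is the tree's single-conjunct layout (Sub = Summit).
set_option linter.dupNamespace false

namespace Summit.ValiantsHypothesis.ValiantsHypothesis.Theorems

namespace PerHomExpansion

open Literature.Computability.AlgebraicComplexity
open Literature.RepresentationTheory.ClassicalInvariants

universe u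

variable {K : Type*} [CommRing K]

/-! ### The row shadow `x_ij ↦ u_i` -/

/-- **Row shadow of a homomorphism polynomial**: `hom_{F,n}(x_ij ↦ u_i) = n^{|B|} · Π_{a ∈ A} p_{deg a}(u)`.
[cite: DwivediPagoSeppelt2026, eq. (1)] -/
theorem rowShadow_homPoly {A B : Type u} [Fintype A] [DecidableEq A] [Fintype B] [DecidableEq B]
    (E : Multiset (A × B)) (n : ℕ) :
    aeval (fun p : Fin n × Fin n => (X p.1 : MvPolynomial (Fin n) K)) (homPoly E n K) =
      ((n ^ Fintype.card B : ℕ) : MvPolynomial (Fin n) K) *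
        ∏ a : A, psum (Fin n) K ((E.map Prod.fst).count a) := by
  unfold homPoly
  rw [map_sum]
  have hterm : ∀ h : (A → Fin n) × (B → Fin n),
      aeval (fun p : Fin n × Fin n => (X p.1 : MvPolynomial (Fin n) K))
          ((E.map fun e => (X (h.1 e.1, h.2 e.2) : MvPolynomial (Fin n × Fin n) K)).prod) =
        ∏ a : A, (X (h.1 a) : MvPolynomial (Fin n) K) ^ (E.map Prod.fst).count a := by
    intro h
    rw [map_multiset_prod, Multiset.map_map]
    simp only [Function.comp_def, aeval_X]
    exact RankOneShadow.prod_map_eq_prod_pow_count E (fun e => e.1) fun a => (X (h.1 a) : MvPolynomial (Fin n) K)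
  simp only [hterm]
  rw [Fintype.sum_prod_type]
  simp only [Finset.sum_const, Finset.card_univ, Fintype.card_fun, Fintype.card_fin]
  rw [← Finset.smul_sum, RankOneShadow.sum_prod_eq_prod_sum n fun (a : A) (i : Fin n) =>
    (X i : MvPolynomial (Fin n) K) ^ (E.map Prod.fst).count a, nsmul_eq_mul]
  rfl

/-- **Row shadow of the permanent**: `per_n(x_ij ↦ u_i) = n! · u_1 ⋯ u_n`. [folklore] -/
theorem rowShadow_perPoly (n : ℕ) :
    aeval (fun p : Fin n × Fin n => (X p.1 : MvPolynomial (Fin n) K)) (perPoly (Fin n) K) =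
      (n.factorial : MvPolynomial (Fin n) K) * ∏ i : Fin n, X i := by
  classical
  simp only [perPoly, Matrix.permanent, Matrix.mvPolynomialX_apply, map_sum, map_prod, aeval_X]
  have hσ : ∀ σ : Equiv.Perm (Fin n), ∏ i : Fin n, (X (σ i) : MvPolynomial (Fin n) K) = ∏ i : Fin n, X i :=
    fun σ => Equiv.prod_comp σ fun i => (X i : MvPolynomial (Fin n) K)
  simp only [hσ, Finset.sum_const, Finset.card_univ, Fintype.card_perm, Fintype.card_fin, nsmul_eq_mul]

/-- `u_1 ⋯ u_n = e_n(u)` in `n` variables. [folklore] -/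
theorem prod_X_eq_esymm (n : ℕ) : (∏ i : Fin n, X i : MvPolynomial (Fin n) K) = esymm (Fin n) K n := by
  have h : Finset.powersetCard n (Finset.univ : Finset (Fin n)) = {Finset.univ} := by
    simpa using Finset.powersetCard_self (Finset.univ : Finset (Fin n))
  rw [esymm, h, Finset.sum_singleton]

/-! ### Products of power sums as images of monomials in `K[y]`, `y_j ↦ p_{j+1}` -/

/-- The power sum `p_d` is homogeneous of degree `d`. [folklore] -/
theorem isHomogeneous_psum (n d : ℕ) : (psum (Fin n) K d).IsHomogeneous d := by
  rw [psum]
  exact IsHomogeneous.sum _ _ _ fun i _ => isHomogeneous_X_pow i d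

/-- A product of power sums `Π_a p_{d a}` is homogeneous of degree `Σ_a d a`. [folklore] -/
theorem isHomogeneous_prod_psum {A : Type u} [Fintype A] (n : ℕ) (d : A → ℕ) :
    (∏ a : A, psum (Fin n) K (d a)).IsHomogeneous (∑ a : A, d a) :=
  IsHomogeneous.prod _ _ _ fun a _ => isHomogeneous_psum n (d a)

/-- **Products of power sums are images of monomials** under `y_j ↦ p_{j+1}`: for degrees `d a ≤ n`,
`Π_a p_{d a} = n^{#\{a : d a = 0\}} · (Π_{a : d a ≠ 0} y_{d a − 1})(p)`, and the exponent vector has weight `Σ_a d a`.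
[cite: DwivediPagoSeppelt2026, eq. (1)] -/
theorem exists_expVec {A : Type u} [Fintype A] [DecidableEq A] (n : ℕ) (d : A → ℕ) (hd : ∀ a, d a ≤ n) :
    ∃ mv : Fin n →₀ ℕ, (∑ j : Fin n, mv j * ((j : ℕ) + 1)) = ∑ a : A, d a ∧
      (∏ a : A, psum (Fin n) K (d a)) =
        ((n ^ (Finset.univ.filter fun a => d a = 0).card : ℕ) : MvPolynomial (Fin n) K) *
          aeval (fun j : Fin n => psum (Fin n) K ((j : ℕ) + 1)) (monomial mv (1 : K)) := by
  classical
  -- the exponent vector of one part `k` (`1 ≤ k ≤ n`): `δ_{k-1}`; of the empty part: `0`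
  let v : ℕ → (Fin n →₀ ℕ) := fun k => if h : 0 < k ∧ k ≤ n then Finsupp.single (⟨k - 1, by omega⟩ : Fin n) 1 else 0
  have hvw : ∀ k, k ≤ n → (∑ j : Fin n, v k j * ((j : ℕ) + 1)) = k := by
    intro k hk
    by_cases h0 : 0 < k
    · simp only [v, dif_pos (And.intro h0 hk), Finsupp.single_apply, ite_mul, one_mul, zero_mul,
        Finset.sum_ite_eq, Finset.mem_univ, if_true]
      omega
    · have : k = 0 := by omega
      subst this
      simp [v]
  have hvp : ∀ k, k ≤ n → psum (Fin n) K k =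
      ((if k = 0 then (n : MvPolynomial (Fin n) K) else 1)) *
        aeval (fun j : Fin n => psum (Fin n) K ((j : ℕ) + 1)) (monomial (v k) (1 : K)) := by
    intro k hk
    by_cases h0 : 0 < k
    · have hk0 : k ≠ 0 := by omega
      simp only [v, dif_pos (And.intro h0 hk), if_neg hk0, one_mul]
      rw [← X_pow_eq_monomial, pow_one, aeval_X]
      congr 1
      show k = k - 1 + 1
      omega
    · have : k = 0 := by omega
      subst this
      simp [v, psum_zero]
  refine ⟨∑ a : A, v (d a), ?_, ?_⟩
  · simp only [Finsupp.coe_finsetSum, Finset.sum_apply, Finset.sum_mul]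
    rw [Finset.sum_comm]
    exact Finset.sum_congr rfl fun a _ => hvw (d a) (hd a)
  · rw [monomial_sum_one, map_prod, Finset.prod_congr rfl fun a _ => hvp (d a) (hd a), Finset.prod_mul_distrib]
    congr 1
    rw [Finset.prod_ite, Finset.prod_const_one, mul_one, Finset.prod_const, Nat.cast_pow]

/-! ### Counting weight-`n` exponent vectors: at least `2^t` when `Σ_{j<t} (j+2) ≤ n` -/

/-- **Many partitions**: if `Σ_{j<t} (j+2) ≤ n`, the subsets `S ⊆ {0, …, t-1}` give `2^t` distinct exponent vectors
`m_S = Σ_{j ∈ S} δ_{j+1} + (n − Σ_{j∈S}(j+2)) δ_0` of weight `n` (partitions of `n` into distinct parts from `{2, …, t+1}`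
and ones), so any finset containing all weight-`n` vectors has `≥ 2^t` elements. [folklore] -/
theorem card_weightVectors_ge (n t : ℕ) (ht : (∑ j : Fin t, ((j : ℕ) + 2)) ≤ n) (s : Finset (Fin n →₀ ℕ))
    (hs : ∀ mv : Fin n →₀ ℕ, (∑ j : Fin n, mv j * ((j : ℕ) + 1)) = n → mv ∈ s) : 2 ^ t ≤ s.card := by
  classical
  rcases Nat.eq_zero_or_pos t with rfl | htpos
  · -- one weight-`n` vector always exists: `n · δ_0` (or `0` if `n = 0`)
    rcases Nat.eq_zero_or_pos n with hn | hn
    · subst hn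
      have : (0 : Fin 0 →₀ ℕ) ∈ s := hs 0 (by simp)
      simpa using Finset.card_pos.2 ⟨_, this⟩
    · have : Finsupp.single (⟨0, hn⟩ : Fin n) n ∈ s := hs _ (by
        simp only [Finsupp.single_apply, ite_mul, zero_mul, Finset.sum_ite_eq, Finset.mem_univ, if_true]
        simp)
      simpa using Finset.card_pos.2 ⟨_, this⟩
  have hn : 0 < n := by
    have : ((⟨0, htpos⟩ : Fin t) : ℕ) + 2 ≤ ∑ j : Fin t, ((j : ℕ) + 2) :=
      Finset.single_le_sum (f := fun j : Fin t => (j : ℕ) + 2) (fun j _ => Nat.zero_le _) (Finset.mem_univ _)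
    omega
  have htn : t < n := by
    have h' : ((⟨t - 1, by omega⟩ : Fin t) : ℕ) + 2 ≤ ∑ j : Fin t, ((j : ℕ) + 2) :=
      Finset.single_le_sum (f := fun j : Fin t => (j : ℕ) + 2) (fun j _ => Nat.zero_le _) (Finset.mem_univ _)
    have h'' : t - 1 + 2 ≤ ∑ j : Fin t, ((j : ℕ) + 2) := h'
    omega
  -- the injection `S ↦ m_S`
  let emb : Fin t → Fin n := fun j => ⟨(j : ℕ) + 1, by omega⟩
  let f : Finset (Fin t) → (Fin n →₀ ℕ) := fun S =>
    (∑ j ∈ S, Finsupp.single (emb j) 1) + Finsupp.single (⟨0, hn⟩ : Fin n) (n - ∑ j ∈ S, ((j : ℕ) + 2))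
  have hfS : ∀ (S : Finset (Fin t)) (j : Fin t), f S (emb j) = if j ∈ S then 1 else 0 := by
    intro S j
    simp only [f, Finsupp.coe_add, Pi.add_apply, Finsupp.coe_finsetSum, Finset.sum_apply, Finsupp.single_apply]
    have h0 : ((⟨0, hn⟩ : Fin n) = emb j) = False := by
      simp only [emb, Fin.mk.injEq]; simp
    simp only [h0, if_false, add_zero]
    have hemb : ∀ i : Fin t, (emb i = emb j) = (i = j) := by
      intro i; simp only [emb, Fin.mk.injEq, add_left_inj, Fin.val_inj]
    simp only [hemb]
    rw [Finset.sum_ite_eq']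

  have hinj : Set.InjOn f (Finset.univ.powerset : Finset (Finset (Fin t))) := by
    intro S _ S' _ hSS'
    ext j
    have h := congrArg (fun g : Fin n →₀ ℕ => g (emb j)) hSS'
    simp only [hfS] at h
    by_cases h1 : j ∈ S <;> by_cases h2 : j ∈ S' <;> simp_all
  have hweight : ∀ S : Finset (Fin t), (∑ i : Fin n, f S i * ((i : ℕ) + 1)) = n := by
    intro S
    have hle : (∑ j ∈ S, ((j : ℕ) + 2)) ≤ n :=
      (Finset.sum_le_sum_of_subset_of_nonneg (Finset.subset_univ S) fun _ _ _ => Nat.zero_le _).trans ht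
    set N := ∑ j ∈ S, ((j : ℕ) + 2) with hN
    have hN' : (∑ j ∈ S, (((j : ℕ) + 1) + 1)) = N := by rw [hN]
    have hexp : ∀ i : Fin n, f S i =
        (∑ j ∈ S, if emb j = i then 1 else 0) + (if (⟨0, hn⟩ : Fin n) = i then n - N else 0) := by
      intro i
      simp only [f, Finsupp.coe_add, Pi.add_apply, Finsupp.coe_finsetSum, Finset.sum_apply, Finsupp.single_apply]
      rfl
    simp only [hexp, add_mul, Finset.sum_add_distrib, Finset.sum_mul, ite_mul, zero_mul, one_mul,
      Finset.sum_ite_eq, Finset.mem_univ, if_true]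
    rw [Finset.sum_comm]
    simp only [Finset.sum_ite_eq, Finset.mem_univ, if_true, emb]
    have h0 : (((⟨0, hn⟩ : Fin n) : ℕ) + 1) = 1 := rfl
    rw [h0, mul_one]
    show (∑ j ∈ S, (((j : ℕ) + 1) + 1)) + (n - N) = n
    omega
  calc 2 ^ t = (Finset.univ.powerset : Finset (Finset (Fin t))).card := by
        rw [Finset.card_powerset, Finset.card_univ, Fintype.card_fin]
    _ ≤ s.card := Finset.card_le_card_of_injOn f (fun S _ => hs _ (hweight S)) hinj

/-! ### Growth: `2^t` beats every polynomial in `n_t = Σ_{j<t} (j+2)` -/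

/-- For every `c` some `t` has `(Σ_{j<t} (j+2) + 2)^c < 2^t`. [folklore] -/
theorem exists_two_pow_gt (c : ℕ) : ∃ t : ℕ, ((∑ j : Fin t, ((j : ℕ) + 2)) + 2) ^ c < 2 ^ t := by
  -- `(t+2)^(2c) / 2^t → 0`, and `Σ_{j<t} (j+2) + 2 ≤ (t+2)^2`
  have hlim : Filter.Tendsto (fun k : ℕ => (k : ℝ) ^ (2 * c) / (2 : ℝ) ^ k) Filter.atTop (nhds 0) :=
    tendsto_pow_const_div_const_pow_of_one_lt (2 * c) one_lt_two
  have hsmall : (0 : ℝ) < 1 / 4 ^ c := by positivity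
  obtain ⟨T, hT⟩ := Filter.eventually_atTop.1 (hlim.eventually (gt_mem_nhds hsmall))
  refine ⟨max T 2, ?_⟩
  set t := max T 2 with htdef
  have ht2 : 2 ≤ t := le_max_right _ _
  have hsum : (∑ j : Fin t, ((j : ℕ) + 2)) + 2 ≤ (t + 2) ^ 2 := by
    have : ∑ j : Fin t, ((j : ℕ) + 2) ≤ ∑ _j : Fin t, (t + 1) :=
      Finset.sum_le_sum fun j _ => by have := j.2; omega
    rw [Finset.sum_const, Finset.card_univ, Fintype.card_fin, smul_eq_mul] at this
    nlinarith
  have hreal : ((t : ℝ) + 2) ^ (2 * c) < (2 : ℝ) ^ t := by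
    have h1 := hT t (le_max_left _ _)
    have h2t : (0 : ℝ) < (2 : ℝ) ^ t := by positivity
    have h4c : (0 : ℝ) < (4 : ℝ) ^ c := by positivity
    rw [div_lt_iff₀ h2t] at h1
    -- `(t+2)^(2c) ≤ (2t)^(2c) = 4^c t^(2c)`
    have h3 : ((t : ℝ) + 2) ^ (2 * c) ≤ (4 : ℝ) ^ c * (t : ℝ) ^ (2 * c) := by
      have : (t : ℝ) + 2 ≤ 2 * t := by
        have : (2 : ℝ) ≤ t := by exact_mod_cast ht2
        linarith
      calc ((t : ℝ) + 2) ^ (2 * c) ≤ (2 * (t : ℝ)) ^ (2 * c) := pow_le_pow_left₀ (by positivity) this _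
        _ = (4 : ℝ) ^ c * (t : ℝ) ^ (2 * c) := by rw [mul_pow, pow_mul]; norm_num
    have h4 : (4 : ℝ) ^ c * (t : ℝ) ^ (2 * c) < (4 : ℝ) ^ c * (1 / 4 ^ c * (2 : ℝ) ^ t) :=
      mul_lt_mul_of_pos_left h1 h4c
    have h5 : (4 : ℝ) ^ c * (1 / 4 ^ c * (2 : ℝ) ^ t) = (2 : ℝ) ^ t := by
      field_simp
    linarith
  have hnat : ((∑ j : Fin t, ((j : ℕ) + 2)) + 2) ^ c ≤ (t + 2) ^ (2 * c) := by
    rw [pow_mul]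
    exact Nat.pow_le_pow_left hsum c
  have : ((t + 2) ^ (2 * c) : ℕ) < 2 ^ t := by exact_mod_cast hreal
  omega

/-! ### The calibration: the permanent has no polynomial-dimension homomorphism expansion -/

/-- **The permanent is outside the hypothesis class of R1 (`OrbitRestorationLinearVolumeQP`, stmt-18294), even without
the volume bound**: there are no `c`, `m_n ≤ (n+2)^c`, patterns `F_{n,i}` and coefficients `α_{n,i}` with
`per_n = Σ_{i<m_n} α_{n,i} · hom_{F_{n,i},n}` for every `n`. [cite: DwivediPagoSeppelt2026, Outlook (p. 12)] -/
theorem perPoly_not_polyDimension_homExpansion :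
    ¬ ∃ (c : ℕ) (m : ℕ → ℕ) (a b : (n : ℕ) → Fin (m n) → ℕ)
        (E : (n : ℕ) → (i : Fin (m n)) → Multiset (Fin (a n i) × Fin (b n i))) (α : (n : ℕ) → Fin (m n) → ℂ),
        (∀ n, m n ≤ (n + 2) ^ c) ∧
          ∀ n, perPoly (Fin n) ℂ = ∑ i : Fin (m n), MvPolynomial.C (α n i) * homPoly (E n i) n ℂ := by
  classical
  rintro ⟨c, m, a, b, E, α, hm, hper⟩
  obtain ⟨t, ht⟩ := exists_two_pow_gt c
  -- the level `n = Σ_{j<t} (j+2)`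
  set n : ℕ := ∑ j : Fin t, ((j : ℕ) + 2) with hndef
  let ps : Fin n → MvPolynomial (Fin n) ℂ := fun j => psum (Fin n) ℂ ((j : ℕ) + 1)
  have hinj : Function.Injective (aeval ps) :=
    algebraicIndependent_iff_injective_aeval.1 (PowerSumBasicInvariants.algebraicIndependent_psum n)
  -- degrees of the patterns at level `n`
  let deg : (i : Fin (m n)) → Fin (a n i) → ℕ := fun i v => ((E n i).map Prod.fst).count v
  have hdegsum : ∀ i, ∑ v, deg i v = Multiset.card (E n i) := by
    intro i
    simp only [deg]
    rw [Multiset.sum_count_eq_card (fun _ _ => Finset.mem_univ _), Multiset.card_map]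
  have hdegle : ∀ i, Multiset.card (E n i) = n → ∀ v, deg i v ≤ n := by
    intro i hi v
    rw [← hi, ← hdegsum i]
    exact Finset.single_le_sum (f := deg i) (fun _ _ => Nat.zero_le _) (Finset.mem_univ v)
  -- Step 1: the row shadow of the representation
  have h1 : (n.factorial : MvPolynomial (Fin n) ℂ) * ∏ i : Fin n, X i =
      ∑ i : Fin (m n), MvPolynomial.C (α n i) *
        (((n ^ Fintype.card (Fin (b n i)) : ℕ) : MvPolynomial (Fin n) ℂ) * ∏ v, psum (Fin n) ℂ (deg i v)) := by
    have h := congrArg (aeval fun p : Fin n × Fin n => (X p.1 : MvPolynomial (Fin n) ℂ)) (hper n)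
    rw [rowShadow_perPoly, map_sum] at h
    rw [h]
    refine Finset.sum_congr rfl fun i _ => ?_
    rw [map_mul, aeval_C, algebraMap_eq, rowShadow_homPoly]
  -- Step 2: the degree-`n` component
  have hLhom : ((n.factorial : MvPolynomial (Fin n) ℂ) * ∏ i : Fin n, X i).IsHomogeneous n := by
    have hp : (∏ i : Fin n, (X i : MvPolynomial (Fin n) ℂ)).IsHomogeneous n := by
      have := IsHomogeneous.prod Finset.univ (fun i : Fin n => (X i : MvPolynomial (Fin n) ℂ)) (fun _ => 1)
        fun i _ => isHomogeneous_X ℂ i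
      simpa using this
    have hc : ((n.factorial : MvPolynomial (Fin n) ℂ)).IsHomogeneous 0 := by
      rw [← map_natCast (MvPolynomial.C : ℂ →+* MvPolynomial (Fin n) ℂ)]
      exact isHomogeneous_C _ _
    simpa using hc.mul hp
  have hcomp : ∀ i : Fin (m n), homogeneousComponent n (MvPolynomial.C (α n i) *
      (((n ^ Fintype.card (Fin (b n i)) : ℕ) : MvPolynomial (Fin n) ℂ) * ∏ v, psum (Fin n) ℂ (deg i v))) =
      if n = Multiset.card (E n i) then MvPolynomial.C (α n i) *
        (((n ^ Fintype.card (Fin (b n i)) : ℕ) : MvPolynomial (Fin n) ℂ) * ∏ v, psum (Fin n) ℂ (deg i v)) else 0 := by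
    intro i
    rw [← map_natCast (MvPolynomial.C : ℂ →+* MvPolynomial (Fin n) ℂ), ← mul_assoc, ← map_mul,
      homogeneousComponent_C_mul, homogeneousComponent_of_mem (isHomogeneous_prod_psum n (deg i)), hdegsum i]
    split_ifs <;> simp
  have h2 : (n.factorial : MvPolynomial (Fin n) ℂ) * ∏ i : Fin n, X i =
      ∑ i : Fin (m n), if n = Multiset.card (E n i) then MvPolynomial.C (α n i) *
        (((n ^ Fintype.card (Fin (b n i)) : ℕ) : MvPolynomial (Fin n) ℂ) * ∏ v, psum (Fin n) ℂ (deg i v)) else 0 := by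
    have h := congrArg (homogeneousComponent n) h1
    rw [homogeneousComponent_eq_self hLhom, map_sum] at h
    rw [h]
    exact Finset.sum_congr rfl fun i _ => hcomp i
  -- Step 3: every surviving term is a scalar times the image of ONE monomial of weight `n`
  have hterm : ∀ i : Fin (m n), ∃ (mv : Fin n →₀ ℕ) (γ : ℂ),
      (n = Multiset.card (E n i) → (∑ j : Fin n, mv j * ((j : ℕ) + 1)) = n) ∧
      (if n = Multiset.card (E n i) then MvPolynomial.C (α n i) *
        (((n ^ Fintype.card (Fin (b n i)) : ℕ) : MvPolynomial (Fin n) ℂ) * ∏ v, psum (Fin n) ℂ (deg i v)) else 0) =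
        aeval ps (monomial mv γ) := by
    intro i
    by_cases hi : n = Multiset.card (E n i)
    · obtain ⟨mv, hw, hprod⟩ := exists_expVec (K := ℂ) n (deg i) (hdegle i hi.symm)
      refine ⟨mv, α n i * ((n ^ Fintype.card (Fin (b n i)) : ℕ) : ℂ) *
        ((n ^ (Finset.univ.filter fun v => deg i v = 0).card : ℕ) : ℂ), fun _ => by rw [hw, hdegsum]; exact hi.symm, ?_⟩
      rw [if_pos hi, hprod, ← mul_one (α n i * _ * _), ← C_mul_monomial, map_mul, aeval_C, algebraMap_eq]
      simp only [map_mul, map_natCast]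
      ring
    · exact ⟨0, 0, fun h => absurd h hi, by rw [if_neg hi, monomial_zero', map_zero, map_zero]⟩
  choose mv γ hmvw hmveq using hterm
  -- Step 4: read the identity in `ℂ[y]` through the injective substitution `y_j ↦ p_{j+1}`
  have hex := Literature.RingTheory.MvPolynomial.BlockSymmetric.esymm_mem_adjoin_psum (K := ℂ) (n := n)
    (k := n) le_rfl
  rw [Algebra.adjoin_range_eq_range_aeval] at hex
  obtain ⟨Q₀, hQ₀⟩ := hex
  have hQ₀' : aeval ps Q₀ = esymm (Fin n) ℂ n := hQ₀
  have hident : MvPolynomial.C (n.factorial : ℂ) * Q₀ = ∑ i : Fin (m n), monomial (mv i) (γ i) := by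
    apply hinj
    rw [map_mul, aeval_C, algebraMap_eq, hQ₀', map_natCast, ← prod_X_eq_esymm, h2, map_sum]
    exact Finset.sum_congr rfl fun i _ => hmveq i
  -- Step 5: every weight-`n` exponent vector is one of the `mv i`
  have hall : ∀ w : Fin n →₀ ℕ, (∑ j : Fin n, w j * ((j : ℕ) + 1)) = n →
      w ∈ Finset.univ.image mv := by
    intro w hw
    have hne : coeff w Q₀ ≠ 0 :=
      ElementaryPowerSumSupport.coeff_ne_zero_of_aeval_psum_eq_esymm n n le_rfl Q₀ hQ₀' w hw
    have hne' : coeff w (∑ i : Fin (m n), monomial (mv i) (γ i)) ≠ 0 := by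
      rw [← hident, coeff_C_mul]
      exact mul_ne_zero (by exact_mod_cast n.factorial_ne_zero) hne
    rw [coeff_sum] at hne'
    obtain ⟨i, -, hi⟩ := Finset.exists_ne_zero_of_sum_ne_zero hne'
    rw [coeff_monomial] at hi
    have hwi : mv i = w := by
      by_contra h
      exact hi (if_neg h)
    exact Finset.mem_image.2 ⟨i, Finset.mem_univ _, hwi⟩
  -- Step 6: count
  have hcount : 2 ^ t ≤ (Finset.univ.image mv).card := card_weightVectors_ge n t le_rfl _ hall
  have hle : (Finset.univ.image mv).card ≤ m n :=
    Finset.card_image_le.trans (by rw [Finset.card_univ, Fintype.card_fin])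
  have := hm n
  omega

end PerHomExpansion

end Summit.ValiantsHypothesis.ValiantsHypothesis.Theorems

end
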